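import Literature.AlgebraicGeometry.Motives.FamiliesVHSIsometryTensor
import HarnessLib

/-!
# The dual of an isometric isomorphism of VHS data is isometric; isometrically isomorphic VHS data have the same Cattani–Deligne–Kaplan loci for
# `D^∨`, `Hom(D₁, D₂)` and every `T^{a,b} D`

Topic `Literature/AlgebraicGeometry/Motives` (namespace `Literature.AlgebraicGeometry.Motives.VHSData`), lane `lit-hodgefound` (seat `p08`, row g57-#15).
DEFINITIONS WITH BODIES (`Iso.homIso e₁ e₂ : Hom(D₁, D₂) ≅ Hom(D₁', D₂')`, `Iso.tensorSpace e a b : T^{a,b} D ≅ T^{a,b} D'`) and THEOREMS; no named fact, no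
instance, no notation (D-0026 net debt `0`).  Sequel of `Motives/FamiliesVHSIsometryTensor` (`⊗`, tensor powers) and `Motives/FamiliesVHSDual`
(`dualForm_comp_eq`: the inverse form is invariant under isometries, in contragredient form).

PRINTED SOURCES.  B. Moonen, *Families of motives and the Mumford–Tate conjecture*, Milan J. Math. (2017), §2.1 (p. 3) (the inverse polarization
`Q^∨` on `V^∨`).  P. Deligne, J. Milne, *Tannakian categories*, LNM 900 (1982), §1 (duals in rigid tensor categories), Ex. 2.31.  E. Cattani, P. Deligne,
A. Kaplan, *On the locus of Hodge classes*, J. AMS 8 (1995), §1, Thm 1.1 (the loci `S^{(K)}`).  P. Deligne, LNM 163 (1970), I.1.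

* §1 `Hom.appRat_dualMap_apply` (`(φ^∨)_ℚ χ = χ ∘ φ_ℚ`), **`Iso.isIsometry_hom_dualMap`** (for an isometric ISOMORPHISM `e`, `e.hom^∨ : D₂^∨ → D₁^∨` is an
  isometry of the inverse forms — `dualForm_comp_eq` with the inverse `e.inv_ℚ`), **`Iso.isIsometry_dual_hom`** (`e^∨ = (e⁻¹)^∨` is isometric).
* §2 **`Iso.homIso e₁ e₂`**, **`Iso.tensorSpace e a b`** and their isometry.
* §3 **CDK loci**: `Iso.hodgeLocusOfNormLe_dual_eq`, `Iso.hodgeLocusOfNormLe_hom_eq`, `Iso.hodgeLocusOfNormLe_tensorSpace_eq`; flat-transport loci of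
  `u₁^{⊗a} ⊗ χ^{⊗b}`-type vectors under `e` (`Iso.setOf_exists_isHodgeAt_transport_tensorSpace_eq`).

HONEST SCOPE: an isometry in the sense `Hom.IsIsometry` that is not invertible need not dualize to an isometry (the inverse form sees the cokernel);
the statements are for isomorphisms.  Holomorphy ∕ transversality are not recorded in `VHSData`.

## References

* [Moonen2017FamiliesMotives] B. Moonen, *Families of motives and the Mumford–Tate conjecture*, Milan J. Math. 85 (2017), §2.1 (p. 3).
* [DeligneMilne1982Tannakian] P. Deligne, J. S. Milne, *Tannakian categories*, in LNM 900 (1982), §1, Ex. 2.31.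
* [CattaniDeligneKaplan1995] E. Cattani, P. Deligne, A. Kaplan, *On the locus of Hodge classes*, J. Amer. Math. Soc. 8 (1995), §1, Thm 1.1.
* [Deligne1970] P. Deligne, *Équations différentielles à points singuliers réguliers*, LNM 163 (1970), I.1.
-/

noncomputable section

open CategoryTheory
open scoped TensorProduct

namespace Literature.AlgebraicGeometry.Motives

namespace VHSData

variable {S : Type} [TopologicalSpace S] {k k₁ k₂ : ℤ}

/-! ## §1 Duals of isometric isomorphisms -/

section Dual

variable {D₁ D₂ : VHSData S k}

/-- **`(φ^∨)_ℚ χ = χ ∘ φ_ℚ`** (the rationalization of `φ^∨` is `(φ_ℚ)^∨`, `homRat_dualMap`). [cite: Deligne1970, I.1] -/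
theorem Hom.appRat_dualMap_apply (φ : Hom D₁ D₂) (s : S) (χ : Module.Dual ℚ (D₂.V.fiber s)) :
    φ.dualMap.appRat s χ = χ ∘ₗ φ.appRat s :=
  LinearMap.congr_fun (homRat_dualMap φ s) χ

/-- **For an isometric isomorphism `e : D₁ ≅ D₂`, `e.hom^∨ : D₂^∨ → D₁^∨` is an isometry of the inverse forms**:
`Q₁^∨(χ ∘ e, χ' ∘ e) = Q₂^∨(χ, χ')` (`dualForm_comp_eq` with the inverse `e⁻¹_ℚ`). [cite: Moonen2017FamiliesMotives, §2.1 (p. 3)]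
[cite: DeligneMilne1982Tannakian, §1 and Ex. 2.31] -/
theorem Iso.isIsometry_hom_dualMap (e : Iso D₁ D₂) (he : e.hom.IsIsometry) : e.hom.dualMap.IsIsometry := fun s χ χ' => by
  haveI := D₁.finite_fiber s
  haveI := D₂.finite_fiber s
  calc (D₁.dual.form s).form (e.hom.dualMap.appRat s χ) (e.hom.dualMap.appRat s χ')
      = (D₁.form s).dualForm (χ ∘ₗ e.hom.appRat s) (χ' ∘ₗ e.hom.appRat s) :=
        congrArg₂ (fun a b => (D₁.form s).dualForm a b) (Hom.appRat_dualMap_apply e.hom s χ) (Hom.appRat_dualMap_apply e.hom s χ')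
    _ = (D₂.form s).dualForm χ χ' :=
        dualForm_comp_eq (D₂.form s) (D₁.form s) (e.hom.appRat s) (e.inv.appRat s) (e.hom_appRat_inv_appRat s) (he s) χ χ'

/-- **The dual `e^∨ = (e⁻¹)^∨ : D₁^∨ ≅ D₂^∨` of an isometric isomorphism is isometric.** [cite: Moonen2017FamiliesMotives, §2.1 (p. 3)]
[cite: DeligneMilne1982Tannakian, §1 and Ex. 2.31] -/
theorem Iso.isIsometry_dual_hom (e : Iso D₁ D₂) (he : e.hom.IsIsometry) : e.dual.hom.IsIsometry :=
  e.symm.isIsometry_hom_dualMap (e.isIsometry_inv he)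

/-- **`D₁ ≅ D₂` isometric ⟹ the norm-bounded Hodge loci of `D₁^∨` and `D₂^∨` coincide.** [cite: CattaniDeligneKaplan1995, §1, Thm 1.1] -/
theorem Iso.hodgeLocusOfNormLe_dual_eq (e : Iso D₁ D₂) (he : e.hom.IsIsometry) (p K : ℤ) :
    D₁.dual.hodgeLocusOfNormLe p K = D₂.dual.hodgeLocusOfNormLe p K :=
  e.dual.hodgeLocusOfNormLe_eq (e.isIsometry_dual_hom he) p K

end Dual

/-! ## §2 `Hom(D₁, D₂) ≅ Hom(D₁', D₂')`, `T^{a,b} D ≅ T^{a,b} D'` -/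

section HomIso

variable {D₁ D₁' : VHSData S k₁} {D₂ D₂' : VHSData S k₂}

/-- **`Hom(D₁, D₂) ≅ Hom(D₁', D₂')` from `D₁ ≅ D₁'`, `D₂ ≅ D₂'`** (`Hom = D₁^∨ ⊗ D₂` cast: `(e₁^∨ ⊗ e₂).castMap`). [cite: DeligneMilne1982Tannakian, §1]
[cite: Deligne1970, I.1] -/
def Iso.homIso (e₁ : Iso D₁ D₁') (e₂ : Iso D₂ D₂') : Iso (D₁.hom D₂) (D₁'.hom D₂') := (e₁.dual.tensor e₂).castMap (neg_add_eq_sub k₁ k₂)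

/-- `Iso.homIso` of isometric isomorphisms is isometric. [cite: DeligneMilne1982Tannakian, §1 and Ex. 2.31] -/
theorem Iso.isIsometry_homIso_hom {e₁ : Iso D₁ D₁'} {e₂ : Iso D₂ D₂'} (h₁ : e₁.hom.IsIsometry) (h₂ : e₂.hom.IsIsometry) : (e₁.homIso e₂).hom.IsIsometry :=
  ((e₁.dual.tensor e₂).isIsometry_castMap_hom_iff (neg_add_eq_sub k₁ k₂)).2 ((e₁.isIsometry_dual_hom h₁).tensor h₂)

/-- **`D₁ ≅ D₁'`, `D₂ ≅ D₂'` isometric ⟹ the norm-bounded Hodge loci of `Hom(D₁, D₂)` and `Hom(D₁', D₂')` coincide.** [cite: CattaniDeligneKaplan1995, §1, Thm 1.1] -/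
theorem Iso.hodgeLocusOfNormLe_hom_eq (e₁ : Iso D₁ D₁') (e₂ : Iso D₂ D₂') (h₁ : e₁.hom.IsIsometry) (h₂ : e₂.hom.IsIsometry) (p K : ℤ) :
    (D₁.hom D₂).hodgeLocusOfNormLe p K = (D₁'.hom D₂').hodgeLocusOfNormLe p K :=
  (e₁.homIso e₂).hodgeLocusOfNormLe_eq (Iso.isIsometry_homIso_hom h₁ h₂) p K

end HomIso

section TensorSpace

variable {D D' : VHSData S k}

/-- **`T^{a,b} D ≅ T^{a,b} D'` from `e : D ≅ D'`**: `e^{⊗a} ⊗ (e^∨)^{⊗b}`. [cite: DeligneMilne1982Tannakian, §1] [cite: Deligne1970, I.1] -/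
def Iso.tensorSpace (e : Iso D D') (a b : ℕ) : Iso (D.tensorSpace a b) (D'.tensorSpace a b) := (e.tensorPow a).tensor (e.dual.tensorPow b)

/-- `Iso.tensorSpace` of an isometric isomorphism is isometric. [cite: DeligneMilne1982Tannakian, §1 and Ex. 2.31] -/
theorem Iso.isIsometry_tensorSpace_hom {e : Iso D D'} (h : e.hom.IsIsometry) (a b : ℕ) : (e.tensorSpace a b).hom.IsIsometry :=
  (h.tensorPow a).tensor ((e.isIsometry_dual_hom h).tensorPow b)

/-- **`D ≅ D'` isometric ⟹ the norm-bounded Hodge loci of `T^{a,b} D` and `T^{a,b} D'` coincide.** [cite: CattaniDeligneKaplan1995, §1, Thm 1.1] -/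
theorem Iso.hodgeLocusOfNormLe_tensorSpace_eq (e : Iso D D') (h : e.hom.IsIsometry) (a b : ℕ) (p K : ℤ) :
    (D.tensorSpace a b).hodgeLocusOfNormLe p K = (D'.tensorSpace a b).hodgeLocusOfNormLe p K :=
  (e.tensorSpace a b).hodgeLocusOfNormLe_eq (Iso.isIsometry_tensorSpace_hom h a b) p K

/-- The flat-transport Hodge loci of `z ∈ T^{a,b} V_ℤ,s` and of its image under `e` coincide (no isometry needed). [cite: CattaniDeligneKaplan1995, §1] -/
theorem Iso.setOf_exists_isHodgeAt_transport_tensorSpace_eq (e : Iso D D') (a b : ℕ) (s : S) (p : ℤ) (z : (D.tensorSpace a b).VZ.fiber s) :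
    {t | ∃ γ : Path.Homotopic.Quotient s t, (D'.tensorSpace a b).IsHodgeAt t p ((D'.tensorSpace a b).VZ.transport γ ((e.tensorSpace a b).hom.app s z))} =
      {t | ∃ γ : Path.Homotopic.Quotient s t, (D.tensorSpace a b).IsHodgeAt t p ((D.tensorSpace a b).VZ.transport γ z)} :=
  (e.tensorSpace a b).setOf_exists_isHodgeAt_transport_eq s p z

end TensorSpace

end VHSData

end Literature.AlgebraicGeometry.Motives

end
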